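import Literature.AlgebraicGeometry.Motives.LineSweptQuadricSurfaces
import Literature.AlgebraicGeometry.Motives.LineSweptChowTwo
import Literature.AlgebraicGeometry.Motives.PlanesGenerateChowTwoOfCubicFourteen
import HarnessLib

/-!
# `H_X^{d-2} ∈ ⟨line-swept surfaces⟩` and `CH₂(X) = ⟨line-swept surfaces⟩` for cubic hypersurfaces, `d ≥ 7`

R. Mboro, *Remarks on the `CH₂` of cubic hypersurfaces* (arXiv:1701.04488), Prop. 1.4: "Let
`X ⊂ ℙⁿ⁺¹` … be a smooth cubic hypersurface. Then `H_X^{n-2} ∈ Im(P_* : CH₁(F(X)) → CH₂(X))`. In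
particular, … for `n ≥ 5`, `P_*` is surjective." The printed proof cuts `X` by a `3`-plane `P₀`
tangent along a line of second type and observes that the cubic surface `S = P₀ ∩ X` "is ruled by
lines of `X`: for any `x ∈ S ∖ l₀`, `span(x, l₀) ∩ S` is a plane cubic containing `l₀` with
multiplicity `2`; so that the residual curve is a line passing through `x`", whence
`H_X^{n-2} = [S] = P_*([D])`. This file proves the statement in the tree's rendering of `Im(P_*)`
by LINE-SWEPT classes (`ProjFamily.lineSweptClasses`, `Motives/LineSweptSurfaces`), for `d ≥ 7`, with
a `3`-plane through a PLANE of `X` instead of the tangent `3`-plane (lines of second type are not in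
the tree): for a plane `Π ⊆ X` (`d ≥ 7`,
`Literature.RingTheory.MvPolynomial.exists_isotropic_finrank_three_ge`) and a `3`-plane
`M ⊇ Π`, `M ⊄ X`, the cubic surface `X ∩ M` is `Π ∪ Q` with `Q` a quadric (`F ≡ ℓ q mod 𝔭_M`);
either `Q` contains a plane of `M`, and `X ∩ M` is three planes
(`Motives/HypersurfaceSplitLinearSections`), or every component of the cycle `V₊(q) · [M]` is a
line-swept surface by the residual-line ruling of `Q` (`Motives/LineSweptQuadricSurfaces`, Mboro's
argument verbatim for the quadric).

* `Hypersurface.hyperplaneSectionOnIter_two_mem_closure_lineSweptClasses` — **`H_X^{d-2} ∩ [X] ∈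
  ⟨line-swept⟩` for EVERY integral cubic hypersurface `X ⊆ ℙᵈ⁺¹_k`, `d ≥ 7` (`k` algebraically
  closed, `2 ≠ 0`; no smoothness is needed for this argument)**;
* `Hypersurface.closure_lineSweptClasses_eq_top` — **`CH₂(X) = ⟨line-swept surfaces⟩`** for such
  `X` (with `ProjFamily.mem_zmultiples_sup_closure_lineSweptClasses`, Mboro Thms. 1.2–1.3,
  `Motives/LineSweptChowTwo`): Prop. 1.4's "`P_*` is surjective", here for `d ≥ 7`;
* `Hypersurface.chowTwo_cubic_closure_lineSweptClasses_eq_top` — the same in the binders of the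
  named fact `Mboro2018_chowTwo_cubic` (`n ≥ 7`);
* `Mboro2018_chowTwo_cubic_of_thm28_inputs` — **the named fact follows from its two remaining
  printed inputs in their printed ranges**: Thm. 2.8's consequence "every line-swept class is an
  integral combination of plane classes" for `7 ≤ n ≤ 13`, and Debarre–Manivel's "any two planes
  of `X` are rationally equivalent" for `9 ≤ n ≤ 14` (above these ranges the tree proves both).

Everything is proved; no named facts.

## References

* [Mboro2018] R. Mboro, Remarks on the CH₂ of cubic hypersurfaces, Geom. Dedicata 200 (2019) =
  arXiv:1701.04488: Prop. 1.4 and its proof (p. 8), Thm. 2.8, Cor. 2.9 (p. 12).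
* [Fulton1998] W. Fulton, Intersection Theory, 2nd ed. (1998), Def. 2.3, Prop. 2.3 (b),
  Example 2.5.1.
* [Hartshorne1977] R. Hartshorne, Algebraic Geometry (1977), I Thm. 1.3A, I Thm. 5.1, I Ex. 5.8.
-/

noncomputable section

open CategoryTheory AlgebraicGeometry Order MvPolynomial
open Literature.AlgebraicGeometry.Motives.Segre

universe u

namespace Literature.AlgebraicGeometry.Motives

attribute [local instance] MvPolynomial.gradedAlgebra

/-! ### Classes of cycles supported on a given kind of points -/

/-- **The class of a cycle lies in any subgroup containing the classes of its components** (compact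
scheme: the support is finite and the cycle is the sum of its prime cycles with multiplicities,
Fulton §1.3). [cite: Fulton1998, §1.3] -/
theorem ChowGroup.mk_mem_of_forall_ofPoint_mem {Y : Scheme.{u}} [CompactSpace Y] {d : ℕ}
    {H : AddSubgroup (ChowGroup Y d)} (γ : ↥(cyclesOfDim Y d))
    (h : ∀ (z : Y) (hz : (γ : AlgebraicCycle Y ℤ) z ≠ 0), ChowGroup.ofPoint z (γ.2 z hz) ∈ H) :
    ChowGroup.mk Y d γ ∈ H := by
  classical
  set s := (finite_support_of_compactSpace (γ : AlgebraicCycle Y ℤ)).toFinset with hs_def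
  have hs : Function.support (γ : AlgebraicCycle Y ℤ) ⊆ (s : Set Y) := by simp [hs_def]
  have hmem : ∀ z ∈ s, (γ : AlgebraicCycle Y ℤ) z ≠ 0 := fun z hz ↦ by simpa [hs_def] using hz
  have hγ : γ = ∑ z ∈ s.attach, (γ : AlgebraicCycle Y ℤ) z •
      (⟨primeCycle (z : Y), primeCycle_mem_cyclesOfDim (γ.2 z (hmem z z.2))⟩ : ↥(cyclesOfDim Y d)) := by
    apply Subtype.ext
    rw [AddSubgroup.val_finsetSum]
    simp only [AddSubgroup.coe_zsmul]
    rw [Finset.sum_attach s fun z ↦ (γ : AlgebraicCycle Y ℤ) z • primeCycle z]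
    exact eq_sum_smul_primeCycle_of_support_subset _ hs
  rw [hγ, map_sum]
  refine AddSubgroup.sum_mem _ fun z _ ↦ ?_
  rw [map_zsmul]
  exact AddSubgroup.zsmul_mem _ (h z (hmem z z.2)) _

namespace Hypersurface

open ProjSpace ProjectiveSpace ProjectiveSpaceCells Literature.RingTheory.MvPolynomial ProjFamily

/-! ### `H_X^{d-2} ∈ ⟨line-swept⟩` -/

section Integral

variable {k : Type u} [Field k] [IsAlgClosed k] {d : ℕ} (X : SchemeOver k) [IsIntegral X.left]
  [LocallyOfFiniteType X.hom] (i : X ⟶ projectiveSpace (d + 1) k) [IsClosedImmersion i.left]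
  {F : MvPolynomial (Fin (d + 1 + 1)) k}

/-- **`c₁(𝒪_X(1))^{d-2} ∩ [X]` is an integral combination of line-swept surface classes on a cubic
hypersurface of dimension `d ≥ 7`** (Mboro, Prop. 1.4: `H_X^{n-2} ∈ Im(P_*)`, there for smooth `X`,
`n ≥ 4`). Let `X = V₊(F) ⊆ ℙᵈ⁺¹_k` be an integral cubic hypersurface (`k` algebraically closed,
`2 ≠ 0`, `F` a prime cubic, `d ≥ 7`). A plane `Π ⊆ X` exists (`d ≥ 7`); for a
`3`-plane `M ⊇ Π` not on `X`, `F ≡ ℓ · q mod 𝔭_M` with `V₊(ℓ) ∩ M = Π`, and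
`[X ∩ M] = [Π] + V₊(q) · [M]`. If the quadric `Q = M ∩ V₊(q)` contains a plane of `M` then `X ∩ M`
is three planes of `X` (`sum_mk_primeCycle_eq_hyperplaneSectionOnIter`), which are line-swept
(`IsLinearSubspacePoint.isLineSweptPoint`); otherwise every component of `V₊(q) · [M]` is a
line-swept surface (`isLineSweptPoint_of_mem_quadricSurface`: the residual lines of the planes of `M`
through a line of `Q` sweep `Q` — Mboro's ruling argument). [cite: Mboro2018, Prop. 1.4 and its proof (arXiv:1701.04488, p. 8)] [cite: Fulton1998, Prop. 2.3 (b) and Example 2.5.1] -/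
theorem hyperplaneSectionOnIter_two_mem_closure_lineSweptClasses (hd : 7 ≤ d) (h2 : (2 : k) ≠ 0)
    (hF : F ∈ grading (Fin (d + 1 + 1)) k 3) (hprime : Prime F)
    (hrange : Set.range i.left.base =
      ProjectiveSpectrum.zeroLocus (MvPolynomial.homogeneousSubmodule (Fin (d + 1 + 1)) k) {F})
    {c : ℕ} (hdim : 2 + c = d) {ℓ₀ : MvPolynomial (Fin (d + 1 + 1)) k}
    (hℓ₀ : ℓ₀ ∈ grading (Fin (d + 1 + 1)) k 1) (hℓ₀0 : ℓ₀ ≠ 0)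
    (hX₀ : (formDivisor ℓ₀ hℓ₀ hℓ₀0).Avoids (i.left.base (genericPoint ↥X.left))) :
    hyperplaneSectionOnIter i hℓ₀ hℓ₀0 hX₀ 2 c
        (ChowGroup.mk X.left (2 + c) ⟨primeCycle (genericPoint ↥X.left), primeCycle_mem_cyclesOfDim
          (by rw [Hypersurface.height_genericPoint i hF hprime hrange]; exact_mod_cast hdim.symm)⟩) ∈
      AddSubgroup.closure (lineSweptClasses i) := by
  classical
  haveI : CompactSpace ↥X.left := i.left.isClosedEmbedding.compactSpace
  have hF3 : F.IsHomogeneous 3 := (mem_homogeneousSubmodule 3 F).1 hF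
  have hF0 : F ≠ 0 := hprime.ne_zero
  have hplanes_le := ProjFamily.closure_linearSubspaceClasses_le_closure_lineSweptClasses (i := i) (by omega : 1 ≤ d)
  -- (1) a plane `Π = ℙ(span πv) ⊆ X` (`d ≥ 7`)
  have hF00 : eval (0 : Fin (d + 1 + 1) → k) F = 0 := by
    rw [MvPolynomial.eval_zero]
    change coeff 0 F = 0
    exact hF3.coeff_eq_zero (by simp)
  obtain ⟨Qp, -, hQ3, hQiso⟩ := exists_isotropic_finrank_three_ge (N := d + 1) (by omega) hF3
    (W := ⊥) (by simp) (by intro v hv; rw [(Submodule.mem_bot k).1 hv]; exact hF00)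
  obtain ⟨πv, hπv, hπvspan⟩ := exists_frame_of_finrank_eq hQ3
  have hπiso : ∀ v ∈ Submodule.span k (Set.range πv), eval v F = 0 := by
    rw [hπvspan]; exact hQiso
  -- (2) a point `p` with `F(p) ≠ 0`, and the frame `m = (πv, p)` of the `3`-plane `M`
  obtain ⟨p, hp⟩ : ∃ p : Fin (d + 1 + 1) → k, eval p F ≠ 0 := by
    by_contra h
    push Not at h
    exact hF0 (MvPolynomial.funext fun x => by rw [h x, map_zero])
  have hpπ : p ∉ Submodule.span k (Set.range πv) := fun h => hp (hπiso p h)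
  let m : Fin 4 → Fin (d + 1 + 1) → k := Fin.snoc πv p
  have hm : LinearIndependent k m := linearIndependent_finSnoc.2 ⟨hπv, hpπ⟩
  have hmπ : ∀ a : Fin 3, m a.castSucc = πv a := fun a => Fin.snoc_castSucc (α := fun _ => Fin (d + 1 + 1) → k) _ _ _
  have hm3 : m 3 = p := Fin.snoc_last (α := fun _ => Fin (d + 1 + 1) → k) _ _
  have hπle : Submodule.span k (Set.range πv) ≤ Submodule.span k (Set.range m) :=
    Submodule.span_mono (by rintro _ ⟨a, rfl⟩; exact ⟨a.castSucc, hmπ a⟩)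
  have hpm : p ∈ Submodule.span k (Set.range m) := Submodule.subset_span ⟨3, hm3⟩
  -- (3) the equations `L` of `M` and `ℓ` of `Π` in `M`
  obtain ⟨c', L, hc', hLli, hLhom, hLvan, hLideal⟩ := exists_linearForms_forall_mem_ideal_span_vanishing hm
  obtain rfl : c = c' := by omega
  have hL : ∀ j, L j ∈ grading (Fin (d + 1 + 1)) k 1 := fun j => (mem_homogeneousSubmodule 1 _).2 (hLhom j)
  have hLM : ∀ P : Fin (d + 1 + 1) → k, (∀ j, eval P (L j) = 0) ↔ P ∈ Submodule.span k (Set.range m) := by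
    intro P
    refine ⟨fun hP => ?_, fun hP j => hLvan j P hP⟩
    by_contra hPm
    obtain ⟨lam, hlamhom, hlamvan, hlamP⟩ := exists_linearForm_vanishing_eval_ne_zero hm hPm
    exact hlamP (eval_eq_zero_of_mem_idealSpan_of_forall hP (hLideal lam hlamvan))
  obtain ⟨ℓ, hℓhom, hℓvan, hℓp⟩ := exists_linearForm_vanishing_eval_ne_zero hπv hpπ
  have hℓg : ℓ ∈ grading (Fin (d + 1 + 1)) k 1 := (mem_homogeneousSubmodule 1 _).2 hℓhom
  have hℓ0 : ℓ ≠ 0 := fun h => hℓp (by rw [h, map_zero])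
  -- anything in `(L)` vanishes on `M̂`; `F, ℓ ∉ (L)`
  have hvanL : ∀ G ∈ Ideal.span (Set.range L), ∀ v ∈ Submodule.span k (Set.range m), eval v G = 0 :=
    fun G hG v hv => eval_eq_zero_of_mem_idealSpan_of_forall (fun j => hLvan j v hv) hG
  have hFL : F ∉ Ideal.span (Set.range L) := fun h => hp (hvanL F h p hpm)
  have hℓL : ℓ ∉ Ideal.span (Set.range L) := fun h => hℓp (hvanL ℓ h p hpm)
  have hLℓli : LinearIndependent k (Fin.snoc L ℓ) := by
    refine linearIndependent_finSnoc.2 ⟨hLli, fun h => hℓL ?_⟩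
    have hle : Submodule.span k (Set.range L) ≤ (Ideal.span (Set.range L)).restrictScalars k :=
      Submodule.span_le.mpr Ideal.subset_span
    exact hle h
  have hLℓhom := isHomogeneous_one_snoc hLhom hℓhom
  have hLℓvan : ∀ j, ∀ v ∈ Submodule.span k (Set.range πv),
      eval v (Fin.snoc (α := fun _ => MvPolynomial (Fin (d + 1 + 1)) k) L ℓ j) = 0 := by
    intro j v hv
    refine Fin.lastCases ?_ (fun j' => ?_) j
    · rw [Fin.snoc_last]; exact hℓvan v hv
    · rw [Fin.snoc_castSucc]; exact hLvan j' v (hπle hv)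
  -- (4) `F ∈ (L, ℓ)`: `F ≡ ℓ q mod (L)` with `q` quadratic
  have hFmem : F ∈ Ideal.span (Set.range (Fin.snoc L ℓ)) :=
    mem_idealSpan_of_forall_mem_span_eval_eq_zero hπv hLℓli hLℓhom hLℓvan (by omega) hπiso
  obtain ⟨H, hHhom, hFH⟩ := exists_eq_sum_mul_of_mem_span_of_isHomogeneous (Fin.snoc L ℓ) hLℓhom hFmem
    (by norm_num : 1 ≤ 3) hF3
  set q : MvPolynomial (Fin (d + 1 + 1)) k := H (Fin.last c) with hqdef
  have hq2 : q.IsHomogeneous 2 := hHhom (Fin.last c)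
  have hqg : q ∈ grading (Fin (d + 1 + 1)) k 2 := (mem_homogeneousSubmodule 2 _).2 hq2
  have hFq : F - ℓ * q ∈ Ideal.span (Set.range L) := by
    have h : F - ℓ * q = ∑ j : Fin c, H j.castSucc * L j := by
      rw [hFH, Fin.sum_univ_castSucc]
      simp only [Fin.snoc_castSucc, Fin.snoc_last]
      rw [hqdef]; ring
    rw [h]
    exact Ideal.sum_mem _ fun j _ => Ideal.mul_mem_left _ _ (Ideal.subset_span ⟨j, rfl⟩)
  have hq0 : q ≠ 0 := by
    intro h
    apply hFL
    have := hFq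
    rwa [h, mul_zero, sub_zero] at this
  -- (5) the generic point `w` of `M`, the hyperplanes `V₊(L_j) ⊅ X`
  obtain ⟨w, hw, hwh, -⟩ := exists_point_of_linearIndependent L hLli hLhom (by omega)
  have hFw : F ∉ ProjectiveSpectrum.asHomogeneousIdeal
      (𝒜 := MvPolynomial.homogeneousSubmodule (Fin (d + 1 + 1)) k) w := by
    intro h; apply hFL; rw [← hw]; exact h
  have hav : ∀ j, (formDivisor (L j) (hL j) (hLli.ne_zero j)).Avoids (i.left.base (genericPoint ↥X.left)) := by
    intro j
    refine formDivisor_avoids_base_genericPoint i hF hprime hrange (hL j) (hLli.ne_zero j) fun h => hFL ?_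
    exact Ideal.span_mono (Set.singleton_subset_iff.2 (Set.mem_range_self j)) h
  -- (6) case (i): `Q ⊇` a plane `V₊(L, λ)` of `M` — three planes
  by_cases hcase : ∃ lam : MvPolynomial (Fin (d + 1 + 1)) k, lam.IsHomogeneous 1 ∧
      (∃ v ∈ Submodule.span k (Set.range m), eval v lam ≠ 0) ∧
        ∀ v ∈ Submodule.span k (Set.range m), eval v lam = 0 → eval v q = 0
  · obtain ⟨lam, hlamhom, ⟨v₀, hv₀m, hv₀⟩, hqlam⟩ := hcase
    have hlamL : lam ∉ Ideal.span (Set.range L) := fun h => hv₀ (hvanL lam h v₀ hv₀m)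
    have hLlamli : LinearIndependent k (Fin.snoc L lam) := by
      refine linearIndependent_finSnoc.2 ⟨hLli, fun h => hlamL ?_⟩
      have hle : Submodule.span k (Set.range L) ≤ (Ideal.span (Set.range L)).restrictScalars k :=
        Submodule.span_le.mpr Ideal.subset_span
      exact hle h
    have hLlamhom := isHomogeneous_one_snoc hLhom hlamhom
    -- a frame of the plane `V(L, λ) ∩ M̂` and `q ∈ (L, λ)`
    obtain ⟨x', hx', hx'van⟩ := exists_frame_of_linearIndependent_linearForms (Fin.snoc L lam) hLlamli hLlamhom
    have h3 : d + 1 + 1 - (c + 1) = 3 := by omega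
    let x : Fin 3 → Fin (d + 1 + 1) → k := fun a => x' (a.cast h3.symm)
    have hx : LinearIndependent k x := hx'.comp _ (Fin.cast_injective h3.symm)
    have hxL : ∀ a j, eval (x a) (L j) = 0 := fun a j => by
      have h := hx'van j.castSucc (a.cast h3.symm)
      rwa [Fin.snoc_castSucc] at h
    have hxlam : ∀ a, eval (x a) lam = 0 := fun a => by
      have h := hx'van (Fin.last c) (a.cast h3.symm)
      rwa [Fin.snoc_last] at h
    have hxm : ∀ a, x a ∈ Submodule.span k (Set.range m) := fun a => (hLM (x a)).1 (hxL a)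
    have hxle : Submodule.span k (Set.range x) ≤ Submodule.span k (Set.range m) :=
      Submodule.span_le.2 (by rintro _ ⟨a, rfl⟩; exact hxm a)
    have hlamspan : ∀ v ∈ Submodule.span k (Set.range x), eval v lam = 0 :=
      forall_mem_span_eval_eq_zero_of_isHomogeneous_one hlamhom (by rintro _ ⟨a, rfl⟩; exact hxlam a)
    have hGvan : ∀ j, ∀ v ∈ Submodule.span k (Set.range x),
        eval v (Fin.snoc (α := fun _ => MvPolynomial (Fin (d + 1 + 1)) k) L lam j) = 0 := by
      intro j v hv
      refine Fin.lastCases ?_ (fun j' => ?_) j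
      · rw [Fin.snoc_last]; exact hlamspan v hv
      · rw [Fin.snoc_castSucc]; exact hLvan j' v (hxle hv)
    have hqmem : q ∈ Ideal.span (Set.range (Fin.snoc L lam)) :=
      mem_idealSpan_of_forall_mem_span_eval_eq_zero hx hLlamli hLlamhom hGvan (by omega)
        (fun v hv => hqlam v (hxle hv) (hlamspan v hv))
    obtain ⟨H', hH'hom, hqH'⟩ := exists_eq_sum_mul_of_mem_span_of_isHomogeneous (Fin.snoc L lam) hLlamhom
      hqmem (by norm_num : 1 ≤ 2) hq2
    set ℓ'' : MvPolynomial (Fin (d + 1 + 1)) k := H' (Fin.last c) with hℓ''def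
    have hℓ''hom : ℓ''.IsHomogeneous 1 := hH'hom (Fin.last c)
    have hqlam' : q - lam * ℓ'' ∈ Ideal.span (Set.range L) := by
      have h : q - lam * ℓ'' = ∑ j : Fin c, H' j.castSucc * L j := by
        rw [hqH', Fin.sum_univ_castSucc]
        simp only [Fin.snoc_castSucc, Fin.snoc_last]
        rw [hℓ''def]; ring
      rw [h]
      exact Ideal.sum_mem _ fun j _ => Ideal.mul_mem_left _ _ (Ideal.subset_span ⟨j, rfl⟩)
    -- `F ≡ ℓ · λ · ℓ'' mod (L)`: three planes
    let ℓf : Fin 3 → MvPolynomial (Fin (d + 1 + 1)) k := ![ℓ, lam, ℓ'']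
    have hℓf : ∀ t, ℓf t ∈ grading (Fin (d + 1 + 1)) k 1 := by
      intro t; fin_cases t
      · exact hℓg
      · exact (mem_homogeneousSubmodule 1 _).2 hlamhom
      · exact (mem_homogeneousSubmodule 1 _).2 hℓ''hom
    have hcong : F - ∏ t, ℓf t ∈ ProjectiveSpectrum.asHomogeneousIdeal
        (𝒜 := MvPolynomial.homogeneousSubmodule (Fin (d + 1 + 1)) k) w := by
      change F - ∏ t, ℓf t ∈ (ProjectiveSpectrum.asHomogeneousIdeal
        (𝒜 := MvPolynomial.homogeneousSubmodule (Fin (d + 1 + 1)) k) w).toIdeal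
      rw [hw, Fin.prod_univ_three]
      have h : F - ℓf 0 * ℓf 1 * ℓf 2 = (F - ℓ * q) + ℓ * (q - lam * ℓ'') := by
        change F - ℓ * lam * ℓ'' = _; ring
      rw [h]
      exact Ideal.add_mem _ hFq (Ideal.mul_mem_left _ _ hqlam')
    have hpts := fun t => exists_toIdeal_base_eq_span_snoc i hrange L hL hLli (by omega) hw hFw ℓf hℓf hcong t
    choose z hz hzpl using hpts
    have hz2 : ∀ t, height (z t) = 2 := fun t => by
      have h := (hzpl t).height_eq
      rwa [show d + 1 - (c + 1) = 2 by omega] at h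
    have hsum := sum_mk_primeCycle_eq_hyperplaneSectionOnIter i hF hprime hrange hdim L hL hLli hav hw hFw
      ℓf hℓf hcong z hz2 hz hℓ₀ hℓ₀0 hX₀
    rw [← hsum]
    refine AddSubgroup.sum_mem _ fun t _ => hplanes_le (AddSubgroup.subset_closure ⟨z t, ?_, rfl⟩)
    have h := hzpl t
    rwa [show d + 1 - (c + 1) = 2 by omega] at h
  -- (7) case (ii): `Q` contains no plane of `M`
  have hnoplane : ∀ lam : MvPolynomial (Fin (d + 1 + 1)) k, lam.IsHomogeneous 1 →
      (∀ v ∈ Submodule.span k (Set.range m), eval v lam = 0 → eval v q = 0) →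
        ∀ v ∈ Submodule.span k (Set.range m), eval v lam = 0 := by
    intro lam hlam hql v hv
    by_contra hne
    exact hcase ⟨lam, hlam, ⟨v, hv, hne⟩, hql⟩
  have hqL : q ∉ Ideal.span (Set.range L) := by
    intro h
    exact hℓp (hnoplane ℓ hℓhom (fun v hv _ => hvanL q h v hv) p hpm)
  have hℓw : ℓ ∉ ProjectiveSpectrum.asHomogeneousIdeal
      (𝒜 := MvPolynomial.homogeneousSubmodule (Fin (d + 1 + 1)) k) w := by
    intro h; apply hℓL; rw [← hw]; exact h
  have hqw : q ∉ ProjectiveSpectrum.asHomogeneousIdeal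
      (𝒜 := MvPolynomial.homogeneousSubmodule (Fin (d + 1 + 1)) k) w := by
    intro h; apply hqL; rw [← hw]; exact h
  -- the plane point `zPi ∈ X` over `V₊(L, ℓ)`
  obtain ⟨pPi, hpPi, -, -⟩ := exists_point_of_linearIndependent (Fin.snoc L ℓ) hLℓli hLℓhom (by omega)
  have hpPiX : pPi ∈ Set.range i.left.base := by
    rw [hrange]
    intro G hG
    rw [Set.mem_singleton_iff.mp hG]
    change F ∈ (ProjectiveSpectrum.asHomogeneousIdeal
      (𝒜 := MvPolynomial.homogeneousSubmodule (Fin (d + 1 + 1)) k) pPi).toIdeal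
    rw [hpPi]; exact hFmem
  obtain ⟨zPi, hzPi⟩ := hpPiX
  have hzPi' : (ProjectiveSpectrum.asHomogeneousIdeal
      (𝒜 := MvPolynomial.homogeneousSubmodule (Fin (d + 1 + 1)) k) (i.left.base zPi)).toIdeal =
        Ideal.span (Set.range (Fin.snoc L ℓ)) := by rw [hzPi]; exact hpPi
  have hzPipl : IsLinearSubspacePoint 2 (d + 1) i zPi := by
    have h := isLinearSubspacePoint_of_toIdeal_base_eq_span (i := i) (Fin.snoc L ℓ) hLℓli hLℓhom (by omega) hzPi'
    rwa [show d + 1 - (c + 1) = 2 by omega] at h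
  -- (8) the cycle identity `i_* [X ∩ M] = [Π] + V₊(q) · [M]`
  set Z : AlgebraicCycle (projectiveSpace (d + 1) k).left ℤ :=
    (formDivisor q hqg hq0).primeInter (X := projectiveSpace (d + 1) k) w with hZ
  have hℓqg : ℓ * q ∈ grading (Fin (d + 1 + 1)) k 3 := SetLike.mul_mem_graded hℓg hqg
  have hid : AlgebraicCycle.map i.left height height
      (CartierDivisor.iterInter c (fun j => (formDivisor (L j) (hL j) (hLli.ne_zero j)).pullbackAvoiding i.left (hav j))
        (primeCycle (genericPoint ↥X.left))) =
      primeCycle (i.left.base zPi) + Z := by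
    rw [map_iterInter_primeCycle_eq_primeInter i hF hprime hrange c L hL hLli (by omega) hav w hw hFw,
      primeInter_formDivisor_congr (N := d + 1) three_pos hF hF0 hℓqg (mul_ne_zero hℓ0 hq0) hFw (by
        change F - ℓ * q ∈ (ProjectiveSpectrum.asHomogeneousIdeal
          (𝒜 := MvPolynomial.homogeneousSubmodule (Fin (d + 1 + 1)) k) w).toIdeal
        rw [hw]; exact hFq),
      primeInter_formDivisor_mul (N := d + 1) one_pos two_pos hℓg hℓ0 hqg hq0 hℓw hqw]
    congr 1
    -- `V₊(ℓ) · [M] = [Π]`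
    have hgr : ∀ j, Fin.snoc (α := fun _ => MvPolynomial (Fin (d + 1 + 1)) k) L ℓ j ∈
        grading (Fin (d + 1 + 1)) k 1 := fun j => (mem_homogeneousSubmodule 1 _).2 (hLℓhom j)
    have hw₀ : (ProjectiveSpectrum.asHomogeneousIdeal
        (𝒜 := MvPolynomial.homogeneousSubmodule (Fin (d + 1 + 1)) k) w).toIdeal =
          Ideal.span (Set.range (fun j : Fin c =>
            Fin.snoc (α := fun _ => MvPolynomial (Fin (d + 1 + 1)) k) L ℓ j.castSucc)) := by
      simp only [Fin.snoc_castSucc]; exact hw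
    have key := primeInter_formDivisor_last_eq_primeCycle (N := d + 1) (Fin.snoc L ℓ) hgr hLℓli (by omega)
      hw₀ hzPi'
    rw [← key]
    congr 1
    exact formDivisor_congr (Fin.snoc_last (α := fun _ => MvPolynomial (Fin (d + 1 + 1)) k) ℓ L).symm _ _ _ _ rfl
  -- (9) the support of `Z`: surface points of `Q`, on `X`
  have hw3 : height w = (2 : ℕ) + 1 := by
    rw [hwh, show d + 1 - c = 3 by omega]; rfl
  have hZdim : Z ∈ cyclesOfDim (projectiveSpace (d + 1) k).left 2 :=
    (formDivisor q hqg hq0).primeInter_mem_cyclesOfDim (X := projectiveSpace (d + 1) k) hw3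
  have hZsupp : ∀ x, Z x ≠ 0 → height x = 2 ∧ q ∈ ProjectiveSpectrum.asHomogeneousIdeal
      (𝒜 := MvPolynomial.homogeneousSubmodule (Fin (d + 1 + 1)) k) x ∧ ∀ j, L j ∈
        ProjectiveSpectrum.asHomogeneousIdeal (𝒜 := MvPolynomial.homogeneousSubmodule (Fin (d + 1 + 1)) k) x := by
    intro x hx
    refine ⟨hZdim x hx, ?_, fun j => ?_⟩
    · have h := (formDivisor q hqg hq0).not_avoids_of_primeInter_ne_zero (X := projectiveSpace (d + 1) k) hx
      by_contra hqx
      exact h ((formDivisor_avoids_iff hqg hq0 two_pos).2 hqx)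
    · have hwx : w ⤳ x := (formDivisor q hqg hq0).specializes_of_primeInter_ne_zero
        (X := projectiveSpace (d + 1) k) hx
      have hle := specializes_iff_le.1 hwx
      have hLw : L j ∈ (ProjectiveSpectrum.asHomogeneousIdeal
          (𝒜 := MvPolynomial.homogeneousSubmodule (Fin (d + 1 + 1)) k) w).toIdeal := by
        rw [hw]; exact Ideal.subset_span ⟨j, rfl⟩
      exact hle hLw
  -- points of `Q` lie on `X`
  have hQX : ProjectiveSpectrum.zeroLocus (homogeneousSubmodule (Fin (d + 1 + 1)) k)
      (insert q (Set.range L)) ⊆ Set.range i.left.base := by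
    intro x hx
    refine (Set.ext_iff.mp hrange x).mpr ?_
    intro G hG
    rw [Set.mem_singleton_iff.mp hG]
    have hqx : q ∈ ProjectiveSpectrum.asHomogeneousIdeal
        (𝒜 := MvPolynomial.homogeneousSubmodule (Fin (d + 1 + 1)) k) x := hx (Set.mem_insert _ _)
    have hLx : F - ℓ * q ∈ (ProjectiveSpectrum.asHomogeneousIdeal
        (𝒜 := MvPolynomial.homogeneousSubmodule (Fin (d + 1 + 1)) k) x).toIdeal := by
      refine (Ideal.span_le.2 ?_) hFq
      rintro _ ⟨j, rfl⟩
      exact hx (Set.mem_insert_of_mem _ ⟨j, rfl⟩)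
    have h : F = (F - ℓ * q) + ℓ * q := by ring
    rw [h]
    exact Ideal.add_mem _ hLx (Ideal.mul_mem_left _ _ hqx)
  have hZrange : Function.support Z ⊆ Set.range i.left.base := by
    intro x hx
    obtain ⟨-, hqx, hLx⟩ := hZsupp x hx
    refine hQX ?_
    intro G hG
    rcases hG with rfl | ⟨j, rfl⟩
    · exact hqx
    · exact hLx j
  -- (10) restrict to `X`: `[X ∩ M] = [Π] + Z_X` as cycles on `X`
  set ZX : AlgebraicCycle X.left ℤ := cycleRestrictClosed i.left Z with hZX
  have hZX2 : ZX ∈ cyclesOfDim X.left 2 := cycleRestrictClosed_mem_cyclesOfDim i.left hZdim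
  have hiter : CartierDivisor.iterInter c
      (fun j => (formDivisor (L j) (hL j) (hLli.ne_zero j)).pullbackAvoiding i.left (hav j))
      (primeCycle (genericPoint ↥X.left)) = primeCycle zPi + ZX := by
    refine algebraicCycleMap_injective_of_isClosedImmersion i.left ?_
    rw [hid, algebraicCycleMap_add, algebraicCycleMap_primeCycle, hZX, map_cycleRestrictClosed i.left Z hZrange]
  -- (11) classes
  have hdimX : primeCycle (genericPoint ↥X.left) ∈ cyclesOfDim X.left (2 + c) :=
    primeCycle_mem_cyclesOfDim (by rw [Hypersurface.height_genericPoint i hF hprime hrange]; exact_mod_cast hdim.symm)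
  rw [← mk_iterInter_primeCycle_eq_hyperplaneSectionOnIter i hF hprime hrange hdim L hL
    (fun j => hLli.ne_zero j) hav hℓ₀ hℓ₀0 hX₀]
  have hsplit : (⟨CartierDivisor.iterInter c
      (fun j => (formDivisor (L j) (hL j) (hLli.ne_zero j)).pullbackAvoiding i.left (hav j))
      (primeCycle (genericPoint ↥X.left)), CartierDivisor.iterInter_mem_cyclesOfDim c _ hdimX⟩ :
        ↥(cyclesOfDim X.left 2)) =
      ⟨primeCycle zPi, primeCycle_mem_cyclesOfDim hzPipl.height_eq⟩ + ⟨ZX, hZX2⟩ := by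
    apply Subtype.ext
    exact hiter
  rw [hsplit, map_add]
  refine AddSubgroup.add_mem _ (hplanes_le (AddSubgroup.subset_closure ⟨zPi, hzPipl, rfl⟩)) ?_
  -- every component of `Z_X` is a line-swept surface
  refine ChowGroup.mk_mem_of_forall_ofPoint_mem ⟨ZX, hZX2⟩ fun η hη => AddSubgroup.subset_closure ⟨η, ?_, rfl⟩
  have hη : Z (i.left.base η) ≠ 0 := by
    change ZX η ≠ 0 at hη
    rwa [hZX, cycleRestrictClosed_apply] at hη
  obtain ⟨hηi2, hqη, hLη⟩ := hZsupp _ hη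
  have hη2 : height η = 2 := by rw [← height_base_eq_of_isClosedImmersion' i.left]; exact hηi2
  exact isLineSweptPoint_of_mem_quadricSurface X i h2 (by omega) L hLhom hLli m hm hLM hq2 hnoplane hQX hη2 hqη hLη

/-- **`CH₂(X) = ⟨line-swept surfaces⟩` for an integral cubic hypersurface of dimension `d ≥ 7`**
(Mboro, Prop. 1.4: "for `n ≥ 5`, `P_* : CH₁(F(X)) → CH₂(X)` is surjective", there for smooth `X`;
here `d ≥ 7`, any integral `X`, and `Im(P_*)` rendered by `lineSweptClasses`): `CH₂(X) = ℤ h + ⟨line-swept⟩` for every integral cubic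
of dimension `≥ 5` (`ProjFamily.mem_zmultiples_sup_closure_lineSweptClasses`, Thms. 1.2–1.3) and
`h ∈ ⟨line-swept⟩` (`hyperplaneSectionOnIter_two_mem_closure_lineSweptClasses`).
[cite: Mboro2018, Prop. 1.4, Thm. 1.2 and Thm. 1.3 (arXiv:1701.04488, pp. 6–8)] -/
theorem closure_lineSweptClasses_eq_top (hd : 7 ≤ d) (h2 : (2 : k) ≠ 0)
    (hF : F ∈ grading (Fin (d + 1 + 1)) k 3) (hprime : Prime F)
    (hrange : Set.range i.left.base =
      ProjectiveSpectrum.zeroLocus (MvPolynomial.homogeneousSubmodule (Fin (d + 1 + 1)) k) {F}) :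
    AddSubgroup.closure (lineSweptClasses i) = ⊤ := by
  have hF3 : F.IsHomogeneous 3 := (mem_homogeneousSubmodule 3 F).1 hF
  -- a hyperplane `V₊(ℓ₀) ⊅ X`
  obtain ⟨ℓv, hlin, hhom, hFℓ⟩ := exists_linearForms_not_mem_idealSpan (N := d + 1) three_pos hF3
    hprime.ne_zero (c := 1) (by omega)
  have hℓ₀ : ℓv 0 ∈ grading (Fin (d + 1 + 1)) k 1 := (mem_homogeneousSubmodule 1 _).2 (hhom 0)
  have hℓ₀0 : ℓv 0 ≠ 0 := hlin.ne_zero 0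
  have hX₀ : (formDivisor (ℓv 0) hℓ₀ hℓ₀0).Avoids (i.left.base (genericPoint ↥X.left)) := by
    refine formDivisor_avoids_base_genericPoint i hF hprime hrange hℓ₀ hℓ₀0 fun h => hFℓ ?_
    exact Ideal.span_mono (Set.singleton_subset_iff.2 (Set.mem_range_self 0)) h
  have hdim : 2 + (d - 2) = d := by omega
  rw [eq_top_iff]
  intro γ _
  have hmem := ProjFamily.mem_zmultiples_sup_closure_lineSweptClasses X i (by omega) hF hprime hrange hdim
    hℓ₀ hℓ₀0 hX₀ γ
  have hh := hyperplaneSectionOnIter_two_mem_closure_lineSweptClasses X i hd h2 hF hprime hrange hdim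
    hℓ₀ hℓ₀0 hX₀
  exact (sup_le (AddSubgroup.zmultiples_le_of_mem hh) le_rfl) hmem

/-- **`CH₂(X)` is generated by planes as soon as every line-swept class is a combination of plane
classes** (`d ≥ 7`) — the shape of Mboro's Cor. 2.9 (i) from Prop. 1.4 and Thm. 2.8 (`CH₁(F(X))`
generated by lines of `F(X)`, whose images under `P_*` are the planes of `X`).
[cite: Mboro2018, Cor. 2.9 (i), Prop. 1.4 and Thm. 2.8 (arXiv:1701.04488, p. 12)] -/
theorem closure_linearSubspaceClasses_two_eq_top_of_lineSwept_subset (hd : 7 ≤ d) (h2 : (2 : k) ≠ 0)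
    (hF : F ∈ grading (Fin (d + 1 + 1)) k 3) (hprime : Prime F)
    (hrange : Set.range i.left.base =
      ProjectiveSpectrum.zeroLocus (MvPolynomial.homogeneousSubmodule (Fin (d + 1 + 1)) k) {F})
    (hls : lineSweptClasses i ⊆ AddSubgroup.closure (linearSubspaceClasses 2 (d + 1) i)) :
    AddSubgroup.closure (linearSubspaceClasses 2 (d + 1) i) = ⊤ := by
  have h := closure_lineSweptClasses_eq_top X i hd h2 hF hprime hrange
  rw [eq_top_iff, ← h]
  exact (AddSubgroup.closure_le _).2 hls

end Integral

/-! ### In the binders of the named fact -/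

section Fact

/-- **`CH₂` of a smooth cubic hypersurface of dimension `n ≥ 7` over an algebraically closed field
of characteristic zero is generated by the classes of its line-swept surfaces** (Mboro, Prop. 1.4:
`P_*` is surjective), in the binders of `Mboro2018_chowTwo_cubic`: `X` is integral
(`IsSmoothProjective.isIntegral_holds`) and `F` is prime, so `closure_lineSweptClasses_eq_top`
applies. [cite: Mboro2018, Prop. 1.4 (arXiv:1701.04488, p. 8)] -/
theorem chowTwo_cubic_closure_lineSweptClasses_eq_top {k : Type u} [Field k] [IsAlgClosed k] [CharZero k]
    (n : ℕ) {X : SchemeOver k} (F : MvPolynomial (Fin (n + 1 + 1)) k) (i : X ⟶ projectiveSpace (n + 1) k)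
    (hX : IsSmoothProjective n X) (hF : F.IsHomogeneous 3) (hirr : Irreducible F)
    [hi : IsClosedImmersion i.left]
    (hV : Set.range i.left.base =
      ProjectiveSpectrum.zeroLocus (MvPolynomial.homogeneousSubmodule (Fin (n + 1 + 1)) k) {F})
    (hn : 7 ≤ n) :
    AddSubgroup.closure (lineSweptClasses i) = ⊤ := by
  haveI : IsIntegral X.left := IsSmoothProjective.isIntegral_holds hX
  haveI : IsProper (projectiveSpace (n + 1) k).hom := isProper_projectiveSpace (n + 1) k
  haveI : LocallyOfFiniteType X.hom := by rw [← Over.w i]; infer_instance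
  have hprime : Prime F := UniqueFactorizationMonoid.irreducible_iff_prime.1 hirr
  have hFg : F ∈ grading (Fin (n + 1 + 1)) k 3 := (mem_homogeneousSubmodule 3 F).2 hF
  exact closure_lineSweptClasses_eq_top X i hn two_ne_zero hFg hprime hV

/-- **Generation by planes from "line-swept ⊆ ⟨planes⟩"**, in the binders of the fact (`n ≥ 7`).
[cite: Mboro2018, Cor. 2.9 (i) (arXiv:1701.04488, p. 12)] -/
theorem chowGeneratedByLinearSubspaces_two_of_lineSwept_subset {k : Type u} [Field k] [IsAlgClosed k]
    [CharZero k] (n : ℕ) {X : SchemeOver k} (F : MvPolynomial (Fin (n + 1 + 1)) k)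
    (i : X ⟶ projectiveSpace (n + 1) k) (hX : IsSmoothProjective n X) (hF : F.IsHomogeneous 3)
    (hirr : Irreducible F) [hi : IsClosedImmersion i.left]
    (hV : Set.range i.left.base =
      ProjectiveSpectrum.zeroLocus (MvPolynomial.homogeneousSubmodule (Fin (n + 1 + 1)) k) {F})
    (hn : 7 ≤ n) (hls : lineSweptClasses i ⊆ AddSubgroup.closure (linearSubspaceClasses 2 (n + 1) i)) :
    ChowGeneratedByLinearSubspaces 2 (n + 1) i := by
  refine chowGeneratedByLinearSubspaces_of_closure_eq_top ?_
  have h := chowTwo_cubic_closure_lineSweptClasses_eq_top n F i hX hF hirr hV hn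
  rw [eq_top_iff, ← h]
  exact (AddSubgroup.closure_le _).2 hls

end Fact

end Hypersurface

/-! ### What remains of the fact: Thm. 2.8 and Debarre–Manivel, in their printed ranges -/

/-- **Reduction of `Mboro2018_chowTwo_cubic` to its two remaining printed inputs.** The named fact
(Cor. 2.9: `CH₂(X)` generated by planes for `n ≥ 7`, `CH₂(X) ≃ ℤ` for `n ≥ 9`) follows from
(T) for `7 ≤ n ≤ 13`: every line-swept surface class of `X` is an integral combination of plane
classes — the consequence `Im(P_*) ⊆ ⟨planes⟩` of Thm. 2.8 ("`CH₁(F(X))` is generated by lines",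
bend-and-break on `F(X)`), and (DM) for `9 ≤ n ≤ 14`: any two planes of `X` are rationally
equivalent (Debarre–Manivel, `CH₀(F₂(X)) = ℤ`). Indeed `CH₂(X) = ⟨line-swept⟩` for `n ≥ 7`
(`Hypersurface.chowTwo_cubic_closure_lineSweptClasses_eq_top`, Prop. 1.4 + Thms. 1.2–1.3), and above
the two ranges the tree proves generation by planes (`n ≥ 14`) and the equivalence of planes
(`n ≥ 15`) (`Mboro2018_chowTwo_cubic_of_low_inputs`). [cite: Mboro2018, Cor. 2.9 and its proof, Thm. 2.8, Prop. 1.4 (arXiv:1701.04488, pp. 8, 12)] -/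
theorem Mboro2018_chowTwo_cubic_of_thm28_inputs
    (hT : ∀ ⦃k : Type u⦄ [Field k] [IsAlgClosed k] [CharZero k] (n : ℕ) ⦃X : SchemeOver k⦄
      (F : MvPolynomial (Fin (n + 1 + 1)) k) (i : X ⟶ projectiveSpace (n + 1) k),
      IsSmoothProjective n X → F.IsHomogeneous 3 → Irreducible F → IsClosedImmersion i.left →
        Set.range i.left.base =
          ProjectiveSpectrum.zeroLocus (MvPolynomial.homogeneousSubmodule (Fin (n + 1 + 1)) k) {F} →
          7 ≤ n → n ≤ 13 →
            ProjFamily.lineSweptClasses i ⊆ AddSubgroup.closure (linearSubspaceClasses 2 (n + 1) i))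
    (hDM : ∀ ⦃k : Type u⦄ [Field k] [IsAlgClosed k] [CharZero k] (n : ℕ) ⦃X : SchemeOver k⦄
      (F : MvPolynomial (Fin (n + 1 + 1)) k) (i : X ⟶ projectiveSpace (n + 1) k),
      IsSmoothProjective n X → F.IsHomogeneous 3 → Irreducible F → IsClosedImmersion i.left →
        Set.range i.left.base =
          ProjectiveSpectrum.zeroLocus (MvPolynomial.homogeneousSubmodule (Fin (n + 1 + 1)) k) {F} →
          9 ≤ n → n ≤ 14 → ∀ ⦃z z' : ↥X.left⦄, IsLinearSubspacePoint 2 (n + 1) i z →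
            IsLinearSubspacePoint 2 (n + 1) i z' →
              IsRationallyEquivalent (primeCycle z) (primeCycle z') 2) :
    Mboro2018_chowTwo_cubic.{u} := by
  refine Mboro2018_chowTwo_cubic_of_low_inputs ?_ hDM
  intro k _ _ _ n X F i hX hF hirr hi hV h7 h13 z hz
  exact Hypersurface.chowGeneratedByLinearSubspaces_two_of_lineSwept_subset n F i hX hF hirr hV h7
    (hT n F i hX hF hirr hi hV h7 h13) (primeCycle z) (primeCycle_mem_cyclesOfDim hz)

end Literature.AlgebraicGeometry.Motives
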